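import Mathlib.Algebra.ContinuedFractions.ContinuantsRecurrence
import Mathlib.Algebra.ContinuedFractions.Translations
import Literature.NumberTheory.Irrationality.Zudilin2003.CatalanRecursion
import HarnessLib

/-!
# Zudilin 2003, Theorem 2: the continued fraction for Catalan's constant

Source: W. Zudilin, *An Apéry-like difference equation for Catalan's constant*, Electron. J. Combin.
10 (2003), #R14, arXiv:math/0201024 [Zudilin2003Catalan], Theorem 2 (Sect. 1).

HONEST FRAMING (cell `pub-zeta5`): systematic search; no irrationality claim unless certified.

Theorem 2 of the source: "considering `vₙ/uₙ` as convergents of a continued fraction for `G` and making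
the equivalent transform of the fraction [JT, Theorems 2.2 and 2.6] we arrive at
`G = 13/2 / (q(0) + 1⁴·2⁴·p(0)p(2) / (q(1) + ⋯ + (2n-1)⁴(2n)⁴p(n-1)p(n+1) / (q(n) + ⋯)))`,
where `p(n) = 20n² - 8n + 1`, `q(n) = 3520n⁶ + 5632n⁵ + 2064n⁴ - 384n³ - 156n² + 16n + 7`" (eq. (3);
tree: `Zudilin2003.p`, `Zudilin2003.q`, the recursion (2) `IsSolution` and its solutions `u, v` of (4)).

This file types the continued fraction with Mathlib's `GenContFract` (head term `0`; the pair of index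
`0` is `(13/2, q(0))`, the pair of index `n ≥ 1` is `((2n-1)⁴(2n)⁴p(n-1)p(n+1), q(n))`) and PROVES the
"equivalent transform" step for ALL `n`, unconditionally:

* `catalanCF_dens`, `catalanCF_nums` — the continuants are `Bₙ = Λₙ uₙ`, `Aₙ = Λₙ vₙ` with
  `Λₙ = ∏_{j<n} (2j+1)²(2j+2)²p(j)` (the product of the leading coefficients of (2));
* `catalanCF_convs` — **the `n`-th convergent is `vₙ/uₙ`** for every `n`;
* `theorem2` — the statement of Theorem 2 (`convergents → G`) as a `Prop`, with
  `theorem2_of_tendsto` (it follows from the limit clause `vₙ/uₙ → G` alone) and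
  `theorem2_of_theorem1 : theorem1 → theorem2` (the limit clause is the last conjunct of the cited
  Theorem 1, `Zudilin2003.theorem1`; when that clause is proved in the tree, Theorem 2 is unconditional).
-/

noncomputable section

open Filter Finset
open scoped Topology

namespace Literature.NumberTheory.Irrationality.Zudilin2003

/-! ### The leading coefficients of (2) and their products -/

/-- The leading coefficient `c(n) = (2n+1)²(2n+2)²p(n)` of the recursion (2).
[cite: Zudilin2003Catalan, Sect. 1, eq. (2)] -/
def cfLead (n : ℕ) : ℚ := (2 * (n : ℚ) + 1) ^ 2 * (2 * (n : ℚ) + 2) ^ 2 * p (n : ℚ)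

/-- `Λₙ = ∏_{j<n} c(j)`, the normalising factor of the equivalence transform (`Λ₀ = 1`, `Λ₁ = 4`).
[cite: Zudilin2003Catalan, Theorem 2] -/
def cfLeadProd (n : ℕ) : ℚ := ∏ j ∈ range n, cfLead j

/-- `c(n) > 0`. [cite: Zudilin2003Catalan, Sect. 1, eq. (2)] -/
theorem cfLead_pos (n : ℕ) : 0 < cfLead n := lead_pos n

/-- `Λₙ > 0`. [cite: Zudilin2003Catalan, Theorem 2] -/
theorem cfLeadProd_pos (n : ℕ) : 0 < cfLeadProd n := prod_pos fun j _ => cfLead_pos j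

/-- `Λ_{n+1} = Λₙ c(n)`. [cite: Zudilin2003Catalan, Theorem 2] -/
theorem cfLeadProd_succ (n : ℕ) : cfLeadProd (n + 1) = cfLeadProd n * cfLead n := prod_range_succ _ _

/-- `Λ_{n+1} = Λₙ (2n+1)²(2n+2)²p(n)` over `ℝ`. [cite: Zudilin2003Catalan, Theorem 2] -/
theorem cast_cfLeadProd_succ (n : ℕ) :
    ((cfLeadProd (n + 1) : ℚ) : ℝ)
      = (cfLeadProd n : ℝ) * ((2 * (n : ℝ) + 1) ^ 2 * (2 * (n : ℝ) + 2) ^ 2 * p (n : ℝ)) := by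
  rw [cfLeadProd_succ]
  simp only [cfLead, p]
  push_cast
  ring

/-! ### The continued fraction of Theorem 2 -/

/-- The pairs `(partial numerator, partial denominator)` of Theorem 2, indexed from `0` as Mathlib does:
index `0 ↦ (13/2, q(0))`, index `m+1 ↦ ((2m+1)⁴(2m+2)⁴ p(m) p(m+2), q(m+1))` (i.e. `n = m+1` in the printed
`(2n-1)⁴(2n)⁴ p(n-1) p(n+1) / q(n)`). [cite: Zudilin2003Catalan, Theorem 2] -/
def cfPair : ℕ → GenContFract.Pair ℝ
  | 0 => ⟨13 / 2, q (0 : ℝ)⟩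
  | m + 1 => ⟨(2 * (m : ℝ) + 1) ^ 4 * (2 * (m : ℝ) + 2) ^ 4 * p (m : ℝ) * p ((m : ℝ) + 2), q ((m : ℝ) + 1)⟩

/-- **The continued fraction of Theorem 2**:
`13/2 / (q(0) + 1⁴2⁴p(0)p(2) / (q(1) + ⋯ + (2n-1)⁴(2n)⁴p(n-1)p(n+1) / (q(n) + ⋯)))` (head term `0`).
[cite: Zudilin2003Catalan, Theorem 2] -/
def catalanCF : GenContFract ℝ := ⟨0, Stream'.Seq.ofStream cfPair⟩

/-- The `n`-th pair of `catalanCF` is `cfPair n` (the fraction does not terminate).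
[cite: Zudilin2003Catalan, Theorem 2] -/
theorem catalanCF_s_get (n : ℕ) : catalanCF.s.get? n = some (cfPair n) := rfl

/-- The recursion (2) at `n = m+1`, cast to `ℝ`, for any solution `x`:
`(2m+3)²(2m+4)²p(m+1) x_{m+2} = q(m+1) x_{m+1} + (2m+1)²(2m+2)²p(m+2) x_m`.
[cite: Zudilin2003Catalan, Sect. 1, eq. (2)] -/
theorem isSolution_cast {x : ℕ → ℚ} (hx : IsSolution x) (m : ℕ) :
    (2 * (m : ℝ) + 3) ^ 2 * (2 * (m : ℝ) + 4) ^ 2 * p ((m : ℝ) + 1) * (x (m + 2) : ℝ)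
      = q ((m : ℝ) + 1) * (x (m + 1) : ℝ)
        + (2 * (m : ℝ) + 1) ^ 2 * (2 * (m : ℝ) + 2) ^ 2 * p ((m : ℝ) + 2) * (x m : ℝ) := by
  have h := hx (m + 1) (by omega)
  simp only [Nat.add_sub_cancel] at h
  have h' := congrArg (fun y : ℚ => (y : ℝ)) h
  simp only [p, q] at h' ⊢
  push_cast at h' ⊢
  linear_combination h'

/-- **The continuants of Theorem 2's fraction** (the "equivalent transform"): for every solution-pair
statement we prove both indices at once — `Bₙ = Λₙuₙ`, `Aₙ = Λₙvₙ` and the same at `n+1`.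
[cite: Zudilin2003Catalan, Theorem 2] -/
theorem catalanCF_conts_aux : ∀ n : ℕ,
    (catalanCF.dens n = (cfLeadProd n : ℝ) * (u n : ℝ) ∧ catalanCF.nums n = (cfLeadProd n : ℝ) * (v n : ℝ))
    ∧ (catalanCF.dens (n + 1) = (cfLeadProd (n + 1) : ℝ) * (u (n + 1) : ℝ)
      ∧ catalanCF.nums (n + 1) = (cfLeadProd (n + 1) : ℝ) * (v (n + 1) : ℝ))
  | 0 => by
    have h0 : catalanCF.s.get? 0 = some (cfPair 0) := catalanCF_s_get 0
    refine ⟨⟨?_, ?_⟩, ?_, ?_⟩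
    · simp [cfLeadProd, u]
    · simp [cfLeadProd, v, catalanCF]
    · rw [GenContFract.first_den_eq h0, cast_cfLeadProd_succ]
      simp only [cfPair, cfLeadProd, u, zero_add, sol_one, q, p, prod_range_zero]
      push_cast
      ring
    · rw [GenContFract.first_num_eq h0, cast_cfLeadProd_succ]
      simp only [cfPair, cfLeadProd, v, zero_add, sol_one, p, prod_range_zero, catalanCF]
      push_cast
      ring
  | m + 1 => by
    obtain ⟨⟨hd0, hn0⟩, hd1, hn1⟩ := catalanCF_conts_aux m
    have hs : catalanCF.s.get? (m + 1) = some (cfPair (m + 1)) := catalanCF_s_get (m + 1)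
    have hu := isSolution_cast (sol_isSolution 1 (7 / 4)) m
    have hv := isSolution_cast (sol_isSolution 0 (13 / 8)) m
    have hL1 := cast_cfLeadProd_succ m
    have hL2 := cast_cfLeadProd_succ (m + 1)
    refine ⟨⟨hd1, hn1⟩, ?_, ?_⟩
    · rw [show m + 1 + 1 = m + 2 by rfl, GenContFract.dens_recurrence hs hd0 hd1, hL2, hL1]
      simp only [cfPair]
      change _ = _ * ((sol 1 (7 / 4) (m + 2) : ℚ) : ℝ)
      have hd : (u m : ℝ) = ((sol 1 (7 / 4) m : ℚ) : ℝ) := rfl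
      have hd' : (u (m + 1) : ℝ) = ((sol 1 (7 / 4) (m + 1) : ℚ) : ℝ) := rfl
      rw [hd, hd']
      push_cast at hu ⊢
      linear_combination (-((cfLeadProd m : ℝ) * ((2 * (m : ℝ) + 1) ^ 2 * (2 * (m : ℝ) + 2) ^ 2 * p (m : ℝ)))) * hu
    · rw [show m + 1 + 1 = m + 2 by rfl, GenContFract.nums_recurrence hs hn0 hn1, hL2, hL1]
      simp only [cfPair]
      change _ = _ * ((sol 0 (13 / 8) (m + 2) : ℚ) : ℝ)
      have hd : (v m : ℝ) = ((sol 0 (13 / 8) m : ℚ) : ℝ) := rfl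
      have hd' : (v (m + 1) : ℝ) = ((sol 0 (13 / 8) (m + 1) : ℚ) : ℝ) := rfl
      rw [hd, hd']
      push_cast at hv ⊢
      linear_combination (-((cfLeadProd m : ℝ) * ((2 * (m : ℝ) + 1) ^ 2 * (2 * (m : ℝ) + 2) ^ 2 * p (m : ℝ)))) * hv

/-- **`Bₙ = Λₙ uₙ`**: the denominators of the convergents of Theorem 2's fraction.
[cite: Zudilin2003Catalan, Theorem 2] -/
theorem catalanCF_dens (n : ℕ) : catalanCF.dens n = (cfLeadProd n : ℝ) * (u n : ℝ) :=
  (catalanCF_conts_aux n).1.1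

/-- **`Aₙ = Λₙ vₙ`**: the numerators of the convergents of Theorem 2's fraction.
[cite: Zudilin2003Catalan, Theorem 2] -/
theorem catalanCF_nums (n : ℕ) : catalanCF.nums n = (cfLeadProd n : ℝ) * (v n : ℝ) :=
  (catalanCF_conts_aux n).1.2

/-- **The convergents of Theorem 2's continued fraction are `vₙ/uₙ`** (all `n`; PROVED — the
"equivalent transform" of the source). [cite: Zudilin2003Catalan, Theorem 2] -/
theorem catalanCF_convs (n : ℕ) : catalanCF.convs n = ((v n / u n : ℚ) : ℝ) := by
  rw [GenContFract.convs, GenContFract.nums, GenContFract.dens] -- unfold to conts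
  change catalanCF.nums n / catalanCF.dens n = _
  rw [catalanCF_nums, catalanCF_dens]
  have hL : ((cfLeadProd n : ℚ) : ℝ) ≠ 0 := by exact_mod_cast (cfLeadProd_pos n).ne'
  push_cast
  rw [mul_div_mul_left _ _ hL]

/-! ### Theorem 2 -/

/-- **Theorem 2** (statement): the convergents of
`13/2 / (q(0) + 1⁴2⁴p(0)p(2) / (q(1) + ⋯ + (2n-1)⁴(2n)⁴p(n-1)p(n+1) / (q(n) + ⋯)))` tend to Catalan's
constant `G` — "the following expansion holds: `G = …`". [cite: Zudilin2003Catalan, Theorem 2] -/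
def theorem2 : Prop :=
  Tendsto (fun n : ℕ => catalanCF.convs n) atTop
    (𝓝 Literature.NumberTheory.Transcendental.catalanConstant)

/-- **Theorem 2 follows from the limit clause `vₙ/uₙ → G` alone** (the convergents ARE `vₙ/uₙ`).
[cite: Zudilin2003Catalan, Theorem 2] -/
theorem theorem2_of_tendsto
    (h : Tendsto (fun n : ℕ => ((v n / u n : ℚ) : ℝ)) atTop
      (𝓝 Literature.NumberTheory.Transcendental.catalanConstant)) : theorem2 :=
  h.congr fun n => (catalanCF_convs n).symm

/-- **Theorem 1 ⇒ Theorem 2** (only the last conjunct `vₙ/uₙ → G` of the cited Theorem 1 is used).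
[cite: Zudilin2003Catalan, Theorems 1 and 2] -/
theorem theorem2_of_theorem1 (h : theorem1) : theorem2 := theorem2_of_tendsto h.2

end Literature.NumberTheory.Irrationality.Zudilin2003
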